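import Literature.AlgebraicTopology.SingularHomology.SingularChains
import Literature.AlgebraicTopology.SingularHomology.PoincareDuality
import Literature.AlgebraicTopology.SingularHomology.PoincareDualityCorollaries
import Literature.AlgebraicTopology.SingularHomology.OrientationProofs
import Literature.AlgebraicTopology.SingularHomology.CupProduct
import Literature.AlgebraicTopology.SingularHomology.CupProductProofs
import Literature.Geometry.Kaehler.ManifoldFormsPullback

/-! # The cup lemma of line `canonical-cap-filling` for crux `NoGenusTwoDoor`
(stmt-SmoothPoincare4-7842, route SymplecticOrigami), helper of stub `stub_taubesCanonicalCurve`

**Statement.** Let `N` be a closed (compact Hausdorff) topological `4`-manifold, `K` a field with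
`2 ≠ 0`, `μ` a homological `K`-orientation of `N`, and suppose `dim_K H²(N; K) = 1`. Then the cup
product `H¹(N; K) ⊗ H¹(N; K) → H²(N; K)` VANISHES: `a ⌣ b = 0` for all degree-one classes.

**Proof** (all inputs PROVED in the tree).  Graded commutativity
(`cupProduct_gradedComm_holds`, Hatcher Thm. 3.11) gives `a ⌣ a = -(a ⌣ a)`, so `a ⌣ a = 0`
(`2 ≠ 0`); with associativity (`cupProduct_assoc`), `c := a ⌣ b` has
`c ⌣ c = ((a ⌣ b) ⌣ a) ⌣ b = (a ⌣ (b ⌣ a)) ⌣ b = -(a ⌣ (a ⌣ b)) ⌣ b = -((a ⌣ a) ⌣ b) ⌣ b = 0`.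
The cup pairing `H² × H² → K`, `(x, y) ↦ ⟨x ⌣ y, [N]⟩`, of the closed `K`-oriented `N` is perfect
(`isPerfPair_cupPairing_of_field_holds`, Hatcher Prop. 3.38, from the tree's proved Poincaré
duality); if `c ≠ 0` it spans the line `H²(N; K)`, so `⟨c ⌣ d, [N]⟩ = t ⟨c ⌣ c, [N]⟩ = 0` for
every `d = t c`, contradicting perfectness. Hence `c = 0`.

**Role.** For a door (`b₂(N) = 1`) this is the vanishing of `H¹ ⊗ H¹ → H²` over `ℚ`, which
makes every Li–Liu / Okonek–Teleman wall-crossing number of the `b⁺ = 1` manifold zero (the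
hypothesis of the `b⁺ = 1` clause of the Taubes named fact used by `stub_taubesCanonicalCurve`).
Sources: Hatcher, *Algebraic Topology* (2002), Thm. 3.11, Prop. 3.38; triage r1-3 F4
(`TriageEvidence.doorCupSquareZero`).
-/

noncomputable section
-- the prescribed namespace `Summit.<P>.<Sub>.…` duplicates `SmoothPoincare4` (P = Sub)
set_option linter.dupNamespace false
open scoped Manifold ContDiff Topology ContinuousMap
open Set Function TopologicalSpace
open Literature.Geometry.Kaehler (MForm IsSmoothForm IsClosedForm mextDeriv)
open Literature.AlgebraicTopology.SingularHomology

namespace Summit.SmoothPoincare4.SmoothPoincare4.Theorems.NoGenusTwoDoor.CanonicalCapFilling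

universe u v

/-- In any commutative coefficient ring with `2` a non-zero-divisor on the module (here: a field
with `2 ≠ 0`), an element equal to its own negative is zero. [folklore] -/
theorem eq_zero_of_eq_neg_self {K : Type v} [Field K] (hK : (2 : K) ≠ 0) {V : Type*}
    [AddCommGroup V] [Module K V] {x : V} (h : x = -x) : x = 0 := by
  have h2 : (2 : K) • x = 0 := by
    rw [two_smul]
    nth_rewrite 2 [h]
    exact add_neg_cancel x
  rcases smul_eq_zero.mp h2 with h0 | h0
  · exact absurd h0 hK
  · exact h0

/-- **The square of a degree-one class vanishes**: `a ⌣ a = 0` in `H²(X; K)` for `a ∈ H¹(X; K)`,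
`K` a field with `2 ≠ 0` (Hatcher 2002, Thm. 3.11: `a ⌣ a = (-1)^{1·1} a ⌣ a`; graded
commutativity is the tree's proved `cupProduct_gradedComm_holds`). [cite: HatcherAT2002, Thm. 3.11] -/
theorem cupProduct_self_eq_zero_of_degree_one {K : Type v} [Field K] (hK : (2 : K) ≠ 0)
    {X : Type u} [TopologicalSpace X] (a : singularCohomology K K X 1) :
    cupProduct one_add_one_eq_two a a = 0 := by
  have h := cupProduct_gradedComm_holds (R := K) (X := X) one_add_one_eq_two one_add_one_eq_two a a
  rw [mul_one, pow_one, neg_smul, one_smul] at h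
  exact eq_zero_of_eq_neg_self hK h

/-- **The square of a product of two degree-one classes vanishes**:
`(a ⌣ b) ⌣ (a ⌣ b) = 0` in `H⁴(X; K)` for `a, b ∈ H¹(X; K)`, `K` a field with `2 ≠ 0`
(Hatcher 2002, §3.2 p. 211 associativity and Thm. 3.11:
`((a ⌣ b) ⌣ a) ⌣ b = -((a ⌣ a) ⌣ b) ⌣ b = 0`). [cite: HatcherAT2002, Thm. 3.11 and §3.2 p. 211] -/
theorem cupProduct_sq_eq_zero_of_degree_one {K : Type v} [Field K] (hK : (2 : K) ≠ 0)
    {X : Type u} [TopologicalSpace X] (a b : singularCohomology K K X 1) :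
    cupProduct two_add_two_eq_four (cupProduct one_add_one_eq_two a b)
      (cupProduct one_add_one_eq_two a b) = 0 := by
  have h31 : (3 : ℕ) + 1 = 4 := by norm_num
  have h21 : (2 : ℕ) + 1 = 3 := by norm_num
  have h12 : (1 : ℕ) + 2 = 3 := by norm_num
  -- `(ab) ⌣ (ab) = ((ab) ⌣ a) ⌣ b`
  rw [← cupProduct_assoc h21 one_add_one_eq_two h31 two_add_two_eq_four]
  -- `(ab) ⌣ a = a ⌣ (b ⌣ a) = -(a ⌣ (a ⌣ b)) = -((a ⌣ a) ⌣ b) = 0`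
  have hba : cupProduct one_add_one_eq_two b a = -cupProduct one_add_one_eq_two a b := by
    have h := cupProduct_gradedComm_holds (R := K) (X := X) one_add_one_eq_two one_add_one_eq_two b a
    rw [mul_one, pow_one, neg_smul, one_smul] at h
    exact h
  have h3 : cupProduct h21 (cupProduct one_add_one_eq_two a b) a = 0 := by
    rw [cupProduct_assoc one_add_one_eq_two one_add_one_eq_two h21 h12, hba, map_neg,
      ← cupProduct_assoc one_add_one_eq_two one_add_one_eq_two h21 h12,
      cupProduct_self_eq_zero_of_degree_one hK, map_zero, LinearMap.zero_apply, neg_zero]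
  rw [h3, map_zero, LinearMap.zero_apply]

/-- **A square-zero class on a cohomology line of a closed oriented manifold is zero**: if
`dim_K Hᵏ(N; K) = 1` (`k + k = n`) for a closed `K`-oriented `n`-manifold `N` and
`c ⌣ c = 0`, then `c = 0` — the cup pairing `Hᵏ × Hᵏ → K` is perfect (Hatcher 2002,
Prop. 3.38; the tree's proved `isPerfPair_cupPairing_of_field_holds`), and every class of the
line is a multiple of a nonzero `c`. [cite: HatcherAT2002, Prop. 3.38] -/
theorem eq_zero_of_cupProduct_self_eq_zero_of_finrank_eq_one {K : Type v} [Field K]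
    {N : Type u} [TopologicalSpace N] [T2Space N] [CompactSpace N] {k n : ℕ}
    [ChartedSpace (EuclideanSpace ℝ (Fin n)) N] (μ : HomologicalOrientation K N n)
    (hk : k + k = n) (h1 : Module.finrank K (singularCohomology K K N k) = 1)
    (c : singularCohomology K K N k) (hcc : cupProduct hk c c = 0) : c = 0 := by
  by_contra hc
  have hperf : (cupPairing μ hk).IsPerfPair := isPerfPair_cupPairing_of_field_holds
  have hinj : Function.Injective (cupPairing μ hk) := (hperf.bijective_left).1
  have hne : cupPairing μ hk c ≠ 0 := by
    intro h0
    exact hc (hinj (h0.trans (map_zero _).symm))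
  obtain ⟨d, hd⟩ : ∃ d, cupPairing μ hk c d ≠ 0 := by
    by_contra hall
    push Not at hall
    exact hne (LinearMap.ext hall)
  obtain ⟨t, rfl⟩ := (finrank_eq_one_iff_of_nonzero' c hc).mp h1 d
  apply hd
  rw [map_smul, cupPairing_apply, hcc, map_zero, LinearMap.zero_apply, smul_zero]

/-- **THE CUP LEMMA.** On a closed `K`-oriented topological `4`-manifold `N` with
`dim_K H²(N; K) = 1`, `K` a field with `2 ≠ 0`, the cup product of any two degree-one classes
vanishes: `a ⌣ b = 0 ∈ H²(N; K)` for all `a, b ∈ H¹(N; K)` (Hatcher 2002, Thm. 3.11 and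
Prop. 3.38: `(a ⌣ b)² = -(a²)(b²) = 0`, and a square-zero class on the line `H²` is `0` by
perfectness of the cup pairing). For a door (`b₂ = 1`) over `K = ℚ` this kills all
wall-crossing numbers of the `b⁺ = 1` Seiberg–Witten theory (Li–Liu 1995, Thm. 1.2).
[cite: HatcherAT2002, Thm. 3.11 and Prop. 3.38] -/
theorem cupProduct_one_one_eq_zero_of_finrank_two_eq_one {K : Type v} [Field K]
    (hK : (2 : K) ≠ 0) {N : Type u} [TopologicalSpace N] [T2Space N] [CompactSpace N]
    [ChartedSpace (EuclideanSpace ℝ (Fin 4)) N] (μ : HomologicalOrientation K N 4)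
    (h1 : Module.finrank K (singularCohomology K K N 2) = 1)
    (a b : singularCohomology K K N 1) : cupProduct one_add_one_eq_two a b = 0 :=
  eq_zero_of_cupProduct_self_eq_zero_of_finrank_eq_one μ two_add_two_eq_four h1 _
    (cupProduct_sq_eq_zero_of_degree_one hK a b)

/-- **The cup lemma over `ℚ`, orientation-free form**: a closed `ℤ`-orientable topological
`4`-manifold with `dim_ℚ H²(N; ℚ) = 1` has vanishing cup product `H¹(N; ℚ) ⊗ H¹(N; ℚ) → H²(N; ℚ)`
(a `ℤ`-orientable manifold is `ℚ`-orientable: Hatcher 2002, §3.3 p. 235, the tree's proved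
`isOrientableOver_of_int_holds`). [cite: HatcherAT2002, Thm. 3.11, Prop. 3.38 and §3.3 p. 235] -/
theorem cupProduct_one_one_eq_zero_rat {N : Type u} [TopologicalSpace N] [T2Space N]
    [CompactSpace N] [ChartedSpace (EuclideanSpace ℝ (Fin 4)) N] (hμ : IsOrientableOver ℤ N 4)
    (h1 : Module.finrank ℚ (singularCohomology ℚ ℚ N 2) = 1)
    (a b : singularCohomology ℚ ℚ N 1) : cupProduct one_add_one_eq_two a b = 0 := by
  obtain ⟨μ⟩ := isOrientableOver_of_int_holds (R := ℚ) (X := N) hμ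
  exact cupProduct_one_one_eq_zero_of_finrank_two_eq_one (by norm_num) μ h1 a b

/-- **Registered sub-goal `stub_taubesCanonicalCurve_cupLemma`** (one-line form of
`cupProduct_one_one_eq_zero_rat`, the cup lemma over `ℚ` for closed `ℤ`-orientable
`4`-manifolds with `dim_ℚ H² = 1`). [cite: HatcherAT2002, Thm. 3.11 and Prop. 3.38] -/
theorem stub_taubesCanonicalCurve_cupLemma : ∀ (N : Type) [TopologicalSpace N] [T2Space N] [CompactSpace N] [ChartedSpace (EuclideanSpace ℝ (Fin 4)) N], IsOrientableOver ℤ N 4 → Module.finrank ℚ (singularCohomology ℚ ℚ N 2) = 1 → ∀ a b : singularCohomology ℚ ℚ N 1, cupProduct one_add_one_eq_two a b = 0 :=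
  fun _ _ _ _ _ hμ h1 a b ↦ cupProduct_one_one_eq_zero_rat hμ h1 a b

end Summit.SmoothPoincare4.SmoothPoincare4.Theorems.NoGenusTwoDoor.CanonicalCapFilling
end
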